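import Mathlib
import Literature.NumberTheory.EllipticCurves.CMPointsIdentityComponentLabel
import HarnessLib

/-!
# CMPointsOfConductorIdentityComponent

Topic `Literature/NumberTheory/EllipticCurves`. Named literature fact(s) relocated by the gate from `Summits/BirchSwinnertonDyer/BirchSwinnertonDyer/Theorems/AdditiveBranchIMCGordTwoRankZeroOffCaseOnePerPlaceE0GZ.lean`
(accept-time relocation of `[cite]`d propositions written inline in a Summits proposal; human ruling 2026-08-15).
Sources: GrossLMS1991, GrossZagier1986Heegner, Jetchev2008.

* `Literature.NumberTheory.EllipticCurves.cmPointOfConductor_memE0ModRatTorsion_of_exactlyDivides`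
-/

namespace Literature.NumberTheory.EllipticCurves

open scoped Classical Pointwise
open WeierstrassCurve
open NumberField
open IsDedekindDomain
open Literature.NumberTheory.EllipticCurves
open Literature.NumberTheory.EllipticCurves.ModularForms

/-- **CM points of conductor `m` on `X₀(N)` lie in `E⁰` up to rational torsion at the places over a prime `r ∥ N`,
`r ∤ m·d_K` — Gross–Zagier 1986 III (3.1) ∕ Gross 1991 §6 ∕ Jetchev 2008 Prop. 3.1, Cor. 3.2, read PER PLACE `w ∣ r` of
`K[m]` under the generalized Heegner condition `4N ∣ β² − d_K`.** Verbatim (Jetchev 2008, §3.2, Prop. 3.1 ∕ Cor. 3.2,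
p. 816): "Let `v` be a prime in `K` which is a prime of bad reduction for `E`, i.e. `v ∣ N`. For any conductor `c` which
is prime to char(`v`) and any prime `w ∣ v` of `K[c]`, the Heegner divisor class `[(x_c) − (∞)] ∈ J(K[c]_w)` lies, up
to translation by the rational divisor class `[(0) − (∞)]`, in `J⁰(K[c]_w)` … Since the image of the divisor class
`[(0) − (∞)]` under `φ` is a rational torsion point on `E`, we obtain … Corollary 3.2. The Heegner point `y_c` lies, up
to translation by a rational torsion point of `E`, on `E⁰(K[c]_w)`, where `E⁰(K[c]_w)` is the subgroup of `E(K[c]_w)`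
of the points which specialize to the identity component of the Néron model of `E`." (= Gross 1991, p. 245: «for any
place `w` dividing `v` in `K_n` … `y_n` is, up to translation by rational torsion on `E`, in `E⁰`» = [GZ86, III (3.1)
Proposition, p. 256]: at `v ∣ N` split in `K` the sections `x`, `x^σ` reduce to ordinary points of the component
`𝓕_{0,n} ∋ 0` or `𝓕_{n,0} ∋ ∞`.) Transcription (tree vocabulary, exactly as in
`Gross1991_heegnerPoint_sub_ratTorsion_mem_E0_imageFree` and `MemE0ModRatTorsion`): `E′/ℚ` ANY model
(`[E′.IsElliptic]`) with a modular parametrisation datum `Dt` of level `N` (`φ(∞) = O`); `K` imaginary quadratic,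
`ι : K → ℂ`, an orientation `β` with `4N ∣ β² − d_K`; a conductor `m ≥ 1` prime to `N`; `y ∈ E′(K[m])` mapping to
the CM point `φ(x_m)` of conductor `m` (`heegnerPointComplexOfConductor`; the `K[m]`-rational point is DATA, as in
`KolyvaginHeegnerData.map_y`); a prime `r ∣ N`, `r² ∤ N`, `r ∤ d_K` (so `r` splits in `K` and is unramified in
`K[m]`, and at `w ∣ r` a globally minimal model over `ℚ` stays minimal, `E⁰(K[m]_w) = E₀`); `E⁰` is read, as in the
tree's facts, as nonsingular reduction on a GLOBALLY MINIMAL model — here a presented one, `C • E′` for a change of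
variables `C` over `ℚ`, the point being transported by `VariableChange.pointEquivBaseChange`; the group law on `E′(K[m])` is read
with an ARBITRARY `DecidableEq K[m]` (inner instance binder; all instances agree, `Subsingleton`). Conclusion: at every
finite place `w` of `K[m]` with `r ∈ w`, `MemE0ModRatTorsion (C • E′) K[m] w (C • y)`, i.e. `C • y − t ∈ E₀(K[m])_w`
for some torsion point `t ∈ (C • E′)(ℚ)`.
-- TODO(general form): the cited sources print this sentence under the classical Heegner hypothesis `(d_K, N) = 1` (all
primes of `N` split in `K`: GZ86 I §3 p. 227; Gross 1991 §1 p. 235; Jetchev 2008 §1.1); the proof ([GZ86 III §3]: the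
Deligne–Rapoport ∕ Katz–Mazur model of `X₀(N)` over `ℤ_r`, ordinary reduction of a CM point of conductor prime to `r` at
the split prime `r` into the component of a cusp, `φ_*((0) − (∞)) ∈ E(ℚ)_tors` by Manin–Drinfeld, Néron functoriality
of `φ_*`) is local at `r` and is recorded here for the generalized Heegner condition `4N ∣ β² − d_K` (ramification
allowed at OTHER primes `q ∣ N`), which is NOT stated as such in those sources; they do not need `r² ∤ N` either. XL
input (integral models of `X₀(N)` and Néron models of `J₀(N)` are not in the tree); typed ≠ proved ≠ endorsed.
[cite: GrossZagier1986Heegner, III (3.1) Proposition, p. 256] [cite: GrossLMS1991, §6, proof of Prop. 6.2 (1), p. 245]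
[cite: Jetchev2008, Prop. 3.1, Cor. 3.2 (p. 816)] [file NumberTheory/EllipticCurves/CMPointsOfConductorIdentityComponent] -/
def cmPointOfConductor_memE0ModRatTorsion_of_exactlyDivides : Prop :=
  ∀ {N : ℕ} [NeZero N] {E' : WeierstrassCurve ℚ} [E'.IsElliptic]
    (Dt : Literature.NumberTheory.EllipticCurves.ModularForms.ModularParametrizationData E' N)
    {K : Type} [Field K] [NumberField K]
    (_hK : Literature.NumberTheory.EllipticCurves.IsImaginaryQuadratic K) (ι : K →+* ℂ) {β : ℤ}
    (_hβ : (4 * (N : ℤ)) ∣ β ^ 2 - NumberField.discr K) {m : ℕ} (_hm : m ≠ 0) (_hmN : Nat.Coprime m N)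
    [NumberField (Literature.NumberTheory.EllipticCurves.ringClassField K ι m)]
    [DecidableEq (Literature.NumberTheory.EllipticCurves.ringClassField K ι m)]
    (y : (E'.baseChange (Literature.NumberTheory.EllipticCurves.ringClassField K ι m)).toAffine.Point)
    (_hy : WeierstrassCurve.Affine.Point.map
        (Literature.NumberTheory.EllipticCurves.ringClassField K ι m).subtype.toRatAlgHom y =
      Literature.NumberTheory.EllipticCurves.ModularForms.heegnerPointComplexOfConductor Dt
        (NumberField.discr K) β m)
    {r : ℕ} (_hr : r.Prime) (_hrN : r ∣ N) (_hr2 : ¬ r ^ 2 ∣ N) (_hrD : ¬ (r : ℤ) ∣ NumberField.discr K)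
    (C : WeierstrassCurve.VariableChange ℚ) [(C • E').IsGloballyMinimal]
    (w : IsDedekindDomain.HeightOneSpectrum
      (NumberField.RingOfIntegers (Literature.NumberTheory.EllipticCurves.ringClassField K ι m))),
    ((r : ℕ) : NumberField.RingOfIntegers (Literature.NumberTheory.EllipticCurves.ringClassField K ι m)) ∈
        w.asIdeal →
      Literature.NumberTheory.EllipticCurves.MemE0ModRatTorsion (C • E')
        (Literature.NumberTheory.EllipticCurves.ringClassField K ι m) w
        (WeierstrassCurve.VariableChange.pointEquivBaseChange E' C
          (Literature.NumberTheory.EllipticCurves.ringClassField K ι m) y)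

/-! ## §2 The stub's statement from the fact -/

end Literature.NumberTheory.EllipticCurves
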